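import Mathlib
import Summits.AtomisticToContinuum.HydrodynamicLimit.Theorems.InformationPercolationEngineKickFairRelEquilibriumMesoReductionA
import Summits.AtomisticToContinuum.HydrodynamicLimit.Theorems.InformationPercolationEngineKickFairRelEquilibriumMesoReductionBSetup
import Summits.AtomisticToContinuum.HydrodynamicLimit.Theorems.InformationPercolationEngineKickFairRelEquilibriumMesoLongWindowDefs
import HarnessLib

/-!
# `KickFairRelEquilibriumMeso`, line `kinetic-window-cut` (rev 5) — stub `mesoBody_of_long`:
# the reduction `B1 → U → TFL → MesoBody rs` (short-flight cut plus Fatou in the truncation level)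

Prover file (`--supports stmt-AtomisticToContinuum-15177`, wave 1 of lead c8, worker W4) for the registered stub
`mesoBody_of_long : SingleKickBias rs → ShortFlightLG → TruncatedFluctuationLong rs → MesoBody rs` of the checked skeleton
`Cruxes/KickFairRelEquilibriumMeso/Lines/kinetic_window_cut.lean` (rev 5, the LONG-FLIGHT window cut) of the crux
`Summit.AtomisticToContinuum.HydrodynamicLimit.Theses.InformationPercolationEngine.KickFairRelEquilibriumMeso`. It is the landed
first half of the `condition-the-past` reduction (`stub_reductionA`, `…MesoReductionA`: `B1 → CT-a → TF → MesoBody rs`) with the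
INDEX truncation (paid by CT-a) replaced by the SHORT-FLIGHT cut (paid by U) and Fatou in the truncation level.

The body of the crux (`MesoBody rs`) asks `E_{LG} |S_h| ≤ δ` eventually in `N`, uniformly over measurable weights `|h| ≤ 1` of the
typed past, `S_h = fullSum = (ε/(N+1)) Σ_i Σ_{n<cnt_i} h_{i,n}(P_{i,n}) D_{i,n}`, `D = kickDev`, and `KickBoundRel … = ∫⁻ ofReal |fullSum …|`
definitionally. Split the weights by the length of the free flight of sphere `i` ending in the kick: `h = h_L + h_S`,
`h_L := 1_{IsLong A t_N} · h` (kept as this explicit product; measurable — `measurable_longWt` —, `|h_L| ≤ 1`, vanishing off long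
flights: an admissible weight of TFL),
`|h_S| = |h − h_L| ≤ 1_{t − s_i < t_N/A}` (`abs_sub_longWt_le`; `¬ IsLong ↔ t − s_i < t_N/A`). With `β = betaLG`, `ξ = D − β`,
`|ξ| ≤ 4C` a.e. (`ae_forall_abs_kickDev_betaLG_le`), pointwise a.e. (`abs_mul_sum_sum_le_long`)
`|S_h| ≤ (ε/(N+1)) ΣΣ |β| + |(ε/(N+1)) ΣΣ h_L(P) ξ| + 4C · (ε/(N+1)) ΣΣ 1_{t − s_i < t_N/A}`;
integrated (`lintegral_abs_fullSum_le_long`; a.e.-measurability of the first and last integrands through the guarded count `gcnt`,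
`aemeasurable_sum_range_cnt`), the first term is B1's integrand (at `δ/3`), the last is VERBATIM U's integrand (at `δ/(3(4C+1))`,
which fixes `A`). The middle term is the new step (`lintegral_abs_mul_sum_le_of_trunc`): for every integer level `M` its truncation
`1_{n < M+1}` is TFL's integrand at level `A' = (M+1)/(N+1)^{1/3}` for the weight `h_L` (bound `δ/3` for EVERY `A' > 0` once `N ≥ N₃`,
the level being quantified after `N₀` in TFL), and for each fixed `z` the truncated sums equal the full one as soon as
`M ≥ Σ_i cnt_i(z)`; so the full integrand is the pointwise limit (= liminf) of the truncated ones and Fatou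
(`lintegral_liminf_le'`) gives `∫⁻ |middle| ≤ liminf_M ≤ δ/3`. Bookkeeping as in the template: `σ₀ := min (min σ₁ σ₂) (min σ₃ (1/2))`,
`N₀ := max N₁ (max N₂ N₃)`, `δ/3 + δ/3 + 4C·δ/(3(4C+1)) ≤ δ`.
-/

noncomputable section

open MeasureTheory Set Filter Topology
open scoped ENNReal Classical

namespace Summit.AtomisticToContinuum.HydrodynamicLimit.Theorems.KickFairRelEquilibriumMesoLine

open Literature.Analysis.FluidPDE Literature.MathematicalPhysics.KineticTheory
open Summit.AtomisticToContinuum.HydrodynamicLimit.Theorems.KickFairRelEquilibriumMesoNegative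
  (KickBoundRel MesoBody)

variable {σ : ℝ} {N : ℕ}

/-! ## The long-flight part of a weight family -/

/-- **The long-flight part `h_L := 1_{IsLong A tw} · h` of a measurable weight family is measurable** (`IsLong` is a Borel
event of the past, `measurableSet_isLong`). The long-flight part is the weight to which TFL is applied; it is kept as the
explicit product `(if IsLong A tw p then 1 else 0) * h i n p` throughout (no new definition). [folklore] -/
theorem measurable_longWt (A tw : ℝ) {h : Fin (N + 1) → ℕ → Past N → ℝ} (hh : ∀ i n, Measurable (h i n))
    (i : Fin (N + 1)) (n : ℕ) : Measurable (fun p : Past N => (if IsLong A tw p then (1 : ℝ) else 0) * h i n p) := by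
  refine Measurable.mul (Measurable.ite ?_ measurable_const measurable_const) (hh i n)
  exact measurableSet_isLong N A tw

/-- `|h_L| ≤ 1` when `|h| ≤ 1`. [folklore] -/
theorem abs_longWt_le_one (A tw : ℝ) {h : Fin (N + 1) → ℕ → Past N → ℝ} (hhb : ∀ i n p, |h i n p| ≤ 1)
    (i : Fin (N + 1)) (n : ℕ) (p : Past N) : |(if IsLong A tw p then (1 : ℝ) else 0) * h i n p| ≤ 1 := by
  split_ifs
  · rw [one_mul]
    exact hhb i n p
  · rw [zero_mul, abs_zero]
    exact zero_le_one

/-- `h_L` vanishes off long flights. [folklore] -/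
theorem longWt_eq_zero (A tw : ℝ) (h : Fin (N + 1) → ℕ → Past N → ℝ) (i : Fin (N + 1)) (n : ℕ) {p : Past N}
    (hp : ¬ IsLong A tw p) : (if IsLong A tw p then (1 : ℝ) else 0) * h i n p = 0 := by
  rw [if_neg hp, zero_mul]

/-- **The short-flight part is dominated by U's indicator**: `|h − h_L| ≤ 1_{t − s_i < tw/A}` when `|h| ≤ 1`
(`¬ IsLong A tw p ↔ p.2.2.2 − p.2.1 < tw / A`). [folklore] -/
theorem abs_sub_longWt_le (A tw : ℝ) {h : Fin (N + 1) → ℕ → Past N → ℝ} (hhb : ∀ i n p, |h i n p| ≤ 1)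
    (i : Fin (N + 1)) (n : ℕ) (p : Past N) :
    |h i n p - (if IsLong A tw p then (1 : ℝ) else 0) * h i n p| ≤
      (if p.2.2.2 - p.2.1 < tw / A then (1 : ℝ) else 0) := by
  unfold IsLong
  by_cases hl : tw / A ≤ p.2.2.2 - p.2.1
  · rw [if_pos hl, if_neg (not_lt.2 hl), one_mul, sub_self, abs_zero]
  · rw [if_neg hl, if_pos (not_le.1 hl), zero_mul, sub_zero]
    exact hhb i n p

/-! ## The pointwise splitting -/

/-- **The pointwise bias/long/short splitting of a weighted double sum** `c ΣΣ w D` with `|w| ≤ 1`, `D = β + (D − β)`,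
`|D − β| ≤ B`, and a second weight family `wL` with `|w − wL| ≤ S`:
`|c ΣΣ w D| ≤ c ΣΣ |β| + |c ΣΣ wL (D − β)| + B · c ΣΣ S`. [folklore] -/
theorem abs_mul_sum_sum_le_long {ι : Type*} (s : Finset ι) (K : ι → ℕ) (w wL S D β : ι → ℕ → ℝ)
    {c B : ℝ} (hc : 0 ≤ c) (hw : ∀ i n, |w i n| ≤ 1) (hS : ∀ i n, |w i n - wL i n| ≤ S i n)
    (hDβ : ∀ i ∈ s, ∀ n, |D i n - β i n| ≤ B) :
    |c * ∑ i ∈ s, ∑ n ∈ Finset.range (K i), w i n * D i n| ≤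
      c * ∑ i ∈ s, ∑ n ∈ Finset.range (K i), |β i n| +
      |c * ∑ i ∈ s, ∑ n ∈ Finset.range (K i), wL i n * (D i n - β i n)| +
      B * (c * ∑ i ∈ s, ∑ n ∈ Finset.range (K i), S i n) := by
  -- the decomposition `w D = w β + wL (D − β) + (w − wL) (D − β)`
  have hdec : c * ∑ i ∈ s, ∑ n ∈ Finset.range (K i), w i n * D i n =
      c * ∑ i ∈ s, ∑ n ∈ Finset.range (K i), w i n * β i n +
      c * ∑ i ∈ s, ∑ n ∈ Finset.range (K i), wL i n * (D i n - β i n) +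
      c * ∑ i ∈ s, ∑ n ∈ Finset.range (K i), (w i n - wL i n) * (D i n - β i n) := by
    rw [← mul_add, ← mul_add, ← Finset.sum_add_distrib, ← Finset.sum_add_distrib]
    congr 1
    refine Finset.sum_congr rfl fun i _ => ?_
    rw [← Finset.sum_add_distrib, ← Finset.sum_add_distrib]
    refine Finset.sum_congr rfl fun n _ => ?_
    ring
  rw [hdec]
  refine (abs_add_le _ _).trans ((add_le_add (abs_add_le _ _) le_rfl).trans ?_)
  refine add_le_add (add_le_add ?_ le_rfl) ?_
  · -- `|c ΣΣ w β| ≤ c ΣΣ |β|`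
    rw [abs_mul, abs_of_nonneg hc]
    refine mul_le_mul_of_nonneg_left ?_ hc
    refine (Finset.abs_sum_le_sum_abs _ _).trans (Finset.sum_le_sum fun i _ => ?_)
    refine (Finset.abs_sum_le_sum_abs _ _).trans (Finset.sum_le_sum fun n _ => ?_)
    rw [abs_mul]
    calc |w i n| * |β i n| ≤ 1 * |β i n| := mul_le_mul_of_nonneg_right (hw i n) (abs_nonneg _)
      _ = |β i n| := one_mul _
  · -- `|c ΣΣ (w − wL) (D − β)| ≤ B · c ΣΣ S`
    rw [abs_mul, abs_of_nonneg hc, mul_left_comm, Finset.mul_sum]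
    refine mul_le_mul_of_nonneg_left ?_ hc
    refine (Finset.abs_sum_le_sum_abs _ _).trans (Finset.sum_le_sum fun i hi => ?_)
    rw [Finset.mul_sum]
    refine (Finset.abs_sum_le_sum_abs _ _).trans (Finset.sum_le_sum fun n _ => ?_)
    rw [abs_mul, mul_comm B]
    exact mul_le_mul (hS i n) (hDβ i hi n) (abs_nonneg _) ((abs_nonneg _).trans (hS i n))

/-! ## A.e.-measurability under the local Gibbs law -/

/-- **A double sum of measurable terms cut at the collision counts is a.e.-measurable under `LG`**: it agrees on the
good set (`LG`-conull, `localGibbsLaw_compl_good_eq_zero`) with its version over the guarded count `gcnt`, a measurable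
random sum of measurable terms (`measurable_sum_range_of_measurable`). [folklore] -/
theorem aemeasurable_sum_range_cnt (hσ : 0 < σ) (Φ : Flow σ N) (a₀ θ₀ : T3 → ℝ) (u₀ : T3 → V3) (τ : ℝ)
    {T : Fin (N + 1) → ℕ → Phase N → ℝ} (hT : ∀ i n, Measurable (T i n)) :
    AEMeasurable (fun z => ∑ i : Fin (N + 1), ∑ n ∈ Finset.range (cnt Φ τ z i), T i n z)
      (localGibbsLaw σ a₀ u₀ θ₀ N Φ) := by
  have hG : Measurable (fun z => ∑ i : Fin (N + 1), ∑ n ∈ Finset.range (gcnt Φ τ z i), T i n z) :=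
    Finset.measurable_sum _ fun i _ =>
      measurable_sum_range_of_measurable (fun n => hT i n) (measurable_gcnt stub_pastMeasurable hσ Φ τ i)
  refine hG.aemeasurable.congr ?_
  have hgood : ∀ᵐ z ∂(localGibbsLaw σ a₀ u₀ θ₀ N Φ), z ∈ Φ.good :=
    mem_ae_iff.2 (localGibbsLaw_compl_good_eq_zero Φ)
  filter_upwards [hgood] with z hz
  simp only [gcnt, hz, if_true]

/-- **U's integrand (the normalised short-flight count, at threshold `tw / A`) is a.e.-measurable under `LG`.** [folklore] -/
theorem aemeasurable_shortCountFn (hσ : 0 < σ) (Φ : Flow σ N) (a₀ θ₀ : T3 → ℝ) (u₀ : T3 → V3) (τ r A tw : ℝ) :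
    AEMeasurable (fun z => ENNReal.ofReal (hsDiameter σ N / ((N : ℝ) + 1) *
      ∑ i : Fin (N + 1), ∑ n ∈ Finset.range (cnt Φ τ z i),
        (if (past Φ r z i n).2.2.2 - (past Φ r z i n).2.1 < tw / A then (1 : ℝ) else 0)))
      (localGibbsLaw σ a₀ u₀ θ₀ N Φ) := by
  have hT : ∀ (i : Fin (N + 1)) (n : ℕ), Measurable fun z : Phase N =>
      (if (past Φ r z i n).2.2.2 - (past Φ r z i n).2.1 < tw / A then (1 : ℝ) else 0) := by
    intro i n
    have hfl : Measurable (fun z => (past Φ r z i n).2.2.2 - (past Φ r z i n).2.1) :=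
      (measurable_snd.comp (measurable_snd.comp (measurable_snd.comp (measurable_past Φ r i n)))).sub
        (measurable_fst.comp (measurable_snd.comp (measurable_past Φ r i n)))
    exact Measurable.ite (measurableSet_lt hfl measurable_const) measurable_const measurable_const
  exact ((aemeasurable_sum_range_cnt hσ Φ a₀ θ₀ u₀ τ hT).const_mul _).ennreal_ofReal

/-- **The level-`a` truncated fluctuation integrand is a.e.-measurable under `LG`** (measurable weights, continuous `g`;
`measurable_kickDev`, `measurable_betaLG`). [folklore] -/
theorem aemeasurable_truncFn (hσ : 0 < σ) (Φ : Flow σ N) (a₀ θ₀ : T3 → ℝ) (u₀ : T3 → V3) (τ r : ℝ)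
    {g : V3 × V3 × V3 → ℝ} (hg : Continuous g) {h : Fin (N + 1) → ℕ → Past N → ℝ}
    (hhm : ∀ i n, Measurable (h i n)) (a : ℝ) :
    AEMeasurable (fun z => ENNReal.ofReal |hsDiameter σ N / ((N : ℝ) + 1) *
      ∑ i : Fin (N + 1), ∑ n ∈ Finset.range (cnt Φ τ z i),
        (if (n : ℝ) < a then (1 : ℝ) else 0) *
          (h i n (past Φ r z i n) * (kickDev Φ r g i n z - betaLG σ a₀ θ₀ u₀ Φ r g i n z))|)
      (localGibbsLaw σ a₀ u₀ θ₀ N Φ) := by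
  have hT : ∀ (i : Fin (N + 1)) (n : ℕ), Measurable fun z : Phase N =>
      (if (n : ℝ) < a then (1 : ℝ) else 0) *
        (h i n (past Φ r z i n) * (kickDev Φ r g i n z - betaLG σ a₀ θ₀ u₀ Φ r g i n z)) := by
    intro i n
    exact (((hhm i n).comp (measurable_past Φ r i n)).mul
      ((measurable_kickDev Φ r hg i n).sub (measurable_betaLG hσ Φ a₀ θ₀ u₀ r g i n))).const_mul _
  exact ((aemeasurable_sum_range_cnt hσ Φ a₀ θ₀ u₀ τ hT).const_mul _).abs.ennreal_ofReal

/-! ## Fatou in the truncation level -/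

/-- **Fatou in the truncation level.** For a finite family of index cut-offs `K i z` and real terms `T i n z`: if every
integer-level truncation `c Σ_i Σ_{n<K i} 1_{n<M+1} T i n` has an a.e.-measurable `ofReal |·|` with `∫⁻ ≤ b`, then so has
the full double sum — for each `z` the truncated sums equal the full one as soon as `M ≥ Σ_i K i z`, so the full integrand is
the liminf of the truncated ones (`tendsto_atTop_of_eventually_const`, `Tendsto.liminf_eq`) and `lintegral_liminf_le'`
applies. [folklore] -/
theorem lintegral_abs_mul_sum_le_of_trunc {α ι : Type*} [MeasurableSpace α] [Fintype ι] {μ : Measure α}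
    {K : ι → α → ℕ} {T : ι → ℕ → α → ℝ} {c : ℝ} {b : ℝ≥0∞}
    (hmeas : ∀ M : ℕ, AEMeasurable (fun z => ENNReal.ofReal |c * ∑ i, ∑ n ∈ Finset.range (K i z),
      (if (n : ℝ) < (M : ℝ) + 1 then (1 : ℝ) else 0) * T i n z|) μ)
    (hle : ∀ M : ℕ, ∫⁻ z, ENNReal.ofReal |c * ∑ i, ∑ n ∈ Finset.range (K i z),
      (if (n : ℝ) < (M : ℝ) + 1 then (1 : ℝ) else 0) * T i n z| ∂μ ≤ b) :
    ∫⁻ z, ENNReal.ofReal |c * ∑ i, ∑ n ∈ Finset.range (K i z), T i n z| ∂μ ≤ b := by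
  set F : ℕ → α → ℝ≥0∞ := fun M z => ENNReal.ofReal |c * ∑ i, ∑ n ∈ Finset.range (K i z),
      (if (n : ℝ) < (M : ℝ) + 1 then (1 : ℝ) else 0) * T i n z| with hF
  -- pointwise, the truncated integrands are eventually the full one
  have hpt : ∀ z, Tendsto (fun M => F M z) atTop
      (𝓝 (ENNReal.ofReal |c * ∑ i, ∑ n ∈ Finset.range (K i z), T i n z|)) := by
    intro z
    refine tendsto_atTop_of_eventually_const (i₀ := ∑ i, K i z) fun M hM => ?_
    have hsum : ∑ i, ∑ n ∈ Finset.range (K i z), (if (n : ℝ) < (M : ℝ) + 1 then (1 : ℝ) else 0) * T i n z =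
        ∑ i, ∑ n ∈ Finset.range (K i z), T i n z := by
      refine Finset.sum_congr rfl fun i _ => Finset.sum_congr rfl fun n hn => ?_
      have hKi : K i z ≤ ∑ j, K j z :=
        Finset.single_le_sum (f := fun j => K j z) (fun j _ => Nat.zero_le _) (Finset.mem_univ i)
      have hnM : n ≤ M := ((Finset.mem_range.1 hn).le.trans hKi).trans hM
      have hnM' : (n : ℝ) < (M : ℝ) + 1 := by exact_mod_cast Nat.lt_succ_of_le hnM
      rw [if_pos hnM', one_mul]
    simp only [hF, hsum]
  calc ∫⁻ z, ENNReal.ofReal |c * ∑ i, ∑ n ∈ Finset.range (K i z), T i n z| ∂μ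
      = ∫⁻ z, liminf (fun M => F M z) atTop ∂μ := lintegral_congr fun z => ((hpt z).liminf_eq).symm
    _ ≤ liminf (fun M => ∫⁻ z, F M z ∂μ) atTop := lintegral_liminf_le' hmeas
    _ ≤ b := liminf_le_of_frequently_le' (Frequently.of_forall hle)

/-! ## The estimate at fixed `N` -/

/-- **The `L¹(LG)` bias/long/short splitting of the crux's kick sum** (fixed `N`, `σ ≤ 1/2`, `|g| ≤ C`, `|h| ≤ 1`, any `A, tw`):
`E_{LG}|S_h| ≤ E_{LG}[(ε/(N+1)) ΣΣ |β|] + E_{LG}|(ε/(N+1)) ΣΣ h_L(P) (D − β)| + 4C · E_{LG}[(ε/(N+1)) ΣΣ 1_{t − s_i < tw/A}]`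
in the `∫⁻ … ENNReal.ofReal` currency. [folklore] -/
theorem lintegral_abs_fullSum_le_long (hσ : 0 < σ) (hσ2 : σ ≤ 1 / 2) (Φ : Flow σ N) (a₀ θ₀ : T3 → ℝ)
    (u₀ : T3 → V3) (τ r : ℝ) {g : V3 × V3 × V3 → ℝ} {C : ℝ} (hC : ∀ p, |g p| ≤ C)
    {h : Fin (N + 1) → ℕ → Past N → ℝ} (hhb : ∀ i n p, |h i n p| ≤ 1) (A tw : ℝ) :
    ∫⁻ z, ENNReal.ofReal |fullSum Φ τ r g h z| ∂(localGibbsLaw σ a₀ u₀ θ₀ N Φ) ≤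
      ∫⁻ z, ENNReal.ofReal (hsDiameter σ N / ((N : ℝ) + 1) *
          ∑ i : Fin (N + 1), ∑ n ∈ Finset.range (cnt Φ τ z i), |betaLG σ a₀ θ₀ u₀ Φ r g i n z|)
        ∂(localGibbsLaw σ a₀ u₀ θ₀ N Φ) +
      ∫⁻ z, ENNReal.ofReal |hsDiameter σ N / ((N : ℝ) + 1) *
          ∑ i : Fin (N + 1), ∑ n ∈ Finset.range (cnt Φ τ z i),
            ((if IsLong A tw (past Φ r z i n) then (1 : ℝ) else 0) * h i n (past Φ r z i n) *
              (kickDev Φ r g i n z - betaLG σ a₀ θ₀ u₀ Φ r g i n z))|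
        ∂(localGibbsLaw σ a₀ u₀ θ₀ N Φ) +
      ENNReal.ofReal (4 * C) * ∫⁻ z, ENNReal.ofReal (hsDiameter σ N / ((N : ℝ) + 1) *
          ∑ i : Fin (N + 1), ∑ n ∈ Finset.range (cnt Φ τ z i),
            (if (past Φ r z i n).2.2.2 - (past Φ r z i n).2.1 < tw / A then (1 : ℝ) else 0))
        ∂(localGibbsLaw σ a₀ u₀ θ₀ N Φ) := by
  set μ : Measure (Phase N) := localGibbsLaw σ a₀ u₀ θ₀ N Φ with hμ
  have hC0 : 0 ≤ C := (abs_nonneg _).trans (hC 0)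
  have hc0 : 0 ≤ hsDiameter σ N / ((N : ℝ) + 1) := div_nonneg (hsDiameter_pos hσ N).le (by positivity)
  -- the three pieces, as real functions
  set P1 : Phase N → ℝ := fun z => hsDiameter σ N / ((N : ℝ) + 1) *
    ∑ i : Fin (N + 1), ∑ n ∈ Finset.range (cnt Φ τ z i), |betaLG σ a₀ θ₀ u₀ Φ r g i n z| with hP1
  set P2 : Phase N → ℝ := fun z => hsDiameter σ N / ((N : ℝ) + 1) *
    ∑ i : Fin (N + 1), ∑ n ∈ Finset.range (cnt Φ τ z i),
      (if (past Φ r z i n).2.2.2 - (past Φ r z i n).2.1 < tw / A then (1 : ℝ) else 0) with hP2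
  set P3 : Phase N → ℝ := fun z => hsDiameter σ N / ((N : ℝ) + 1) *
    ∑ i : Fin (N + 1), ∑ n ∈ Finset.range (cnt Φ τ z i),
      ((if IsLong A tw (past Φ r z i n) then (1 : ℝ) else 0) * h i n (past Φ r z i n) *
              (kickDev Φ r g i n z - betaLG σ a₀ θ₀ u₀ Φ r g i n z)) with hP3
  have hP1nn : ∀ z, 0 ≤ P1 z := fun z =>
    mul_nonneg hc0 (Finset.sum_nonneg fun i _ => Finset.sum_nonneg fun n _ => abs_nonneg _)
  have hP2nn : ∀ z, 0 ≤ P2 z := fun z =>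
    mul_nonneg hc0 (Finset.sum_nonneg fun i _ => Finset.sum_nonneg fun n _ => by split_ifs <;> norm_num)
  -- the pointwise splitting, a.e.
  have hpt : ∀ᵐ z ∂μ, ENNReal.ofReal |fullSum Φ τ r g h z| ≤
      ENNReal.ofReal (P1 z) + ENNReal.ofReal |P3 z| + ENNReal.ofReal (4 * C) * ENNReal.ofReal (P2 z) := by
    filter_upwards [ae_forall_abs_kickDev_betaLG_le hσ2 Φ a₀ θ₀ u₀ r hC] with z hz
    have hDβ : ∀ i ∈ (Finset.univ : Finset (Fin (N + 1))), ∀ n : ℕ,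
        |kickDev Φ r g i n z - betaLG σ a₀ θ₀ u₀ Φ r g i n z| ≤ 4 * C := by
      intro i _ n
      exact (abs_sub _ _).trans (by linarith [(hz i n).1, (hz i n).2])
    have key := abs_mul_sum_sum_le_long Finset.univ (cnt Φ τ z) (fun i n => h i n (past Φ r z i n))
      (fun i n => (if IsLong A tw (past Φ r z i n) then (1 : ℝ) else 0) * h i n (past Φ r z i n))
      (fun i n => if (past Φ r z i n).2.2.2 - (past Φ r z i n).2.1 < tw / A then (1 : ℝ) else 0)
      (fun i n => kickDev Φ r g i n z) (fun i n => betaLG σ a₀ θ₀ u₀ Φ r g i n z) hc0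
      (fun i n => hhb i n _) (fun i n => abs_sub_longWt_le A tw hhb i n _) hDβ
    rw [← ENNReal.ofReal_mul (by positivity), ← ENNReal.ofReal_add (hP1nn z) (abs_nonneg _),
      ← ENNReal.ofReal_add (add_nonneg (hP1nn z) (abs_nonneg _)) (mul_nonneg (by positivity) (hP2nn z))]
    exact ENNReal.ofReal_le_ofReal key
  -- a.e.-measurability of two of the three pieces
  have hP1ae : AEMeasurable (fun z => ENNReal.ofReal (P1 z)) μ := aemeasurable_biasFn hσ Φ a₀ θ₀ u₀ τ r g
  have hP2ae : AEMeasurable (fun z => ENNReal.ofReal (4 * C) * ENNReal.ofReal (P2 z)) μ :=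
    (aemeasurable_shortCountFn hσ Φ a₀ θ₀ u₀ τ r A tw).const_mul _
  -- integrate
  calc ∫⁻ z, ENNReal.ofReal |fullSum Φ τ r g h z| ∂μ
      ≤ ∫⁻ z, ENNReal.ofReal (P1 z) + ENNReal.ofReal |P3 z| + ENNReal.ofReal (4 * C) * ENNReal.ofReal (P2 z) ∂μ :=
        lintegral_mono_ae hpt
    _ = ∫⁻ z, ENNReal.ofReal (P1 z) + ENNReal.ofReal |P3 z| ∂μ +
          ∫⁻ z, ENNReal.ofReal (4 * C) * ENNReal.ofReal (P2 z) ∂μ := lintegral_add_right' _ hP2ae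
    _ = ∫⁻ z, ENNReal.ofReal (P1 z) ∂μ + ∫⁻ z, ENNReal.ofReal |P3 z| ∂μ +
          ENNReal.ofReal (4 * C) * ∫⁻ z, ENNReal.ofReal (P2 z) ∂μ := by
        rw [lintegral_add_left' hP1ae, lintegral_const_mul' _ _ ENNReal.ofReal_ne_top]

/-! ## The stub -/

/-- **STUB `mesoBody_of_long` — the reduction `B1 → U → TFL → MesoBody rs` of the line `kinetic-window-cut` (rev 5).**
Given `Φ, τ, g (|g| ≤ C), δ` and admissible `h`: B1 at `δ/3` (`N₁`), U at `δ/(3(4C+1))` (giving `A` and `N₂`), TFL at `(A, δ/3)`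
(`N₃`); for `N ≥ max N₁ (max N₂ N₃)` split `S_h` (`lintegral_abs_fullSum_le_long` with `tw = t_N`): the bias term is B1's
integrand, the short term is U's, and the long term `E_{LG}|(ε/(N+1)) ΣΣ h_L(P)(D − β)|` is bounded by `δ/3` through Fatou in
the truncation level (`lintegral_abs_mul_sum_le_of_trunc`): its level-`(M+1)` truncation is TFL's integrand at
`A' = (M+1)/(N+1)^{1/3}` for the admissible long-flight weight `h_L = 1_{IsLong A t_N} · h`. `σ₀ := min (min σ₁ σ₂) (min σ₃ (1/2))`;
`KickBoundRel … = ∫⁻ ofReal |fullSum …|` definitionally. [folklore] -/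
theorem mesoBody_of_long : SingleKickBias rs → ShortFlightLG → TruncatedFluctuationLong rs → MesoBody rs := by
  intro hB1 hU hTF a₀ θ₀ u₀ ha hθ hu ha0 hθ0
  obtain ⟨σ₁, hσ₁, H1⟩ := hB1 a₀ θ₀ u₀ ha hθ hu ha0 hθ0
  obtain ⟨σ₂, hσ₂, H2⟩ := hU a₀ θ₀ u₀ ha hθ hu ha0 hθ0
  obtain ⟨σ₃, hσ₃, H3⟩ := hTF a₀ θ₀ u₀ ha hθ hu ha0 hθ0
  refine ⟨min (min σ₁ σ₂) (min σ₃ (1 / 2)), lt_min (lt_min hσ₁ hσ₂) (lt_min hσ₃ (by norm_num)), ?_⟩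
  intro σ hσ hσlt Φ τ hτ g hg hgb δ hδ
  have hσ1 : σ < σ₁ := hσlt.trans_le ((min_le_left _ _).trans (min_le_left _ _))
  have hσ2' : σ < σ₂ := hσlt.trans_le ((min_le_left _ _).trans (min_le_right _ _))
  have hσ3 : σ < σ₃ := hσlt.trans_le ((min_le_right _ _).trans (min_le_left _ _))
  have hσ12 : σ ≤ 1 / 2 := (hσlt.trans_le ((min_le_right _ _).trans (min_le_right _ _))).le
  obtain ⟨C, hC⟩ := hgb
  have hC0 : 0 ≤ C := (abs_nonneg _).trans (hC 0)
  have h4C1 : 0 < 4 * C + 1 := by positivity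
  obtain ⟨N₁, hN₁⟩ := H1 σ hσ hσ1 Φ τ hτ g hg ⟨C, hC⟩ (δ / 3) (by positivity)
  obtain ⟨A, hA, N₂, hN₂⟩ := H2 σ hσ hσ2' Φ τ hτ (δ / (3 * (4 * C + 1))) (by positivity)
  obtain ⟨N₃, hN₃⟩ := H3 σ hσ hσ3 Φ τ hτ g hg ⟨C, hC⟩ A hA (δ / 3) (by positivity)
  refine ⟨max N₁ (max N₂ N₃), fun N hN h hhm hhb => ?_⟩
  have hN1 : N₁ ≤ N := (le_max_left _ _).trans hN
  have hN2 : N₂ ≤ N := ((le_max_left _ _).trans (le_max_right _ _)).trans hN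
  have hN3 : N₃ ≤ N := ((le_max_right _ _).trans (le_max_right _ _)).trans hN
  -- the goal is the crux's let-chain; it is the local Gibbs mean of `fullSum`
  change ∫⁻ z, ENNReal.ofReal |fullSum (Φ N) τ (rs N) g h z| ∂(localGibbsLaw σ a₀ u₀ θ₀ N (Φ N)) ≤
    ENNReal.ofReal δ
  have h1 := hN₁ N hN1
  have h2 := hN₂ N hN2
  -- the long term: Fatou in the truncation level, each truncation bounded by TFL for the weight `h_L`
  have h3 : ∫⁻ z, ENNReal.ofReal |hsDiameter σ N / ((N : ℝ) + 1) *
      ∑ i : Fin (N + 1), ∑ n ∈ Finset.range (cnt (Φ N) τ z i),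
        ((if IsLong A (tN N) (past (Φ N) (rs N) z i n) then (1 : ℝ) else 0) * h i n (past (Φ N) (rs N) z i n) *
          (kickDev (Φ N) (rs N) g i n z - betaLG σ a₀ θ₀ u₀ (Φ N) (rs N) g i n z))|
        ∂(localGibbsLaw σ a₀ u₀ θ₀ N (Φ N)) ≤ ENNReal.ofReal (δ / 3) := by
    have hP : 0 < ((N : ℝ) + 1) ^ (1 / 3 : ℝ) := by positivity
    refine lintegral_abs_mul_sum_le_of_trunc (fun M => ?_) (fun M => ?_)
    · exact aemeasurable_truncFn hσ (Φ N) a₀ θ₀ u₀ τ (rs N) hg (measurable_longWt A (tN N) hhm) _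
    · have key := hN₃ N hN3 (((M : ℝ) + 1) / ((N : ℝ) + 1) ^ (1 / 3 : ℝ)) (by positivity)
        (fun i n p => (if IsLong A (tN N) p then (1 : ℝ) else 0) * h i n p)
        (measurable_longWt A (tN N) hhm) (abs_longWt_le_one A (tN N) hhb)
        (fun i n p hp => longWt_eq_zero A (tN N) h i n hp)
      rw [div_mul_cancel₀ _ hP.ne'] at key
      exact key
  have key : 4 * C * (δ / (3 * (4 * C + 1))) ≤ δ / 3 := by
    have hq : 4 * C / (4 * C + 1) ≤ 1 := (div_le_one h4C1).2 (by linarith)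
    calc 4 * C * (δ / (3 * (4 * C + 1))) = δ / 3 * (4 * C / (4 * C + 1)) := by
          field_simp
      _ ≤ δ / 3 * 1 := mul_le_mul_of_nonneg_left hq (by positivity)
      _ = δ / 3 := mul_one _
  calc ∫⁻ z, ENNReal.ofReal |fullSum (Φ N) τ (rs N) g h z| ∂(localGibbsLaw σ a₀ u₀ θ₀ N (Φ N))
      ≤ _ := lintegral_abs_fullSum_le_long hσ hσ12 (Φ N) a₀ θ₀ u₀ τ (rs N) hC hhb A (tN N)
    _ ≤ ENNReal.ofReal (δ / 3) + ENNReal.ofReal (δ / 3) +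
          ENNReal.ofReal (4 * C) * ENNReal.ofReal (δ / (3 * (4 * C + 1))) :=
        add_le_add (add_le_add h1 h3) (mul_le_mul_right h2 _)
    _ = ENNReal.ofReal (δ / 3 + δ / 3 + 4 * C * (δ / (3 * (4 * C + 1)))) := by
        rw [← ENNReal.ofReal_mul (by positivity), ← ENNReal.ofReal_add (by positivity) (by positivity),
          ← ENNReal.ofReal_add (by positivity) (by positivity)]
    _ ≤ ENNReal.ofReal δ := ENNReal.ofReal_le_ofReal (by linarith)

end Summit.AtomisticToContinuum.HydrodynamicLimit.Theorems.KickFairRelEquilibriumMesoLine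

end
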